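import Mathlib.Algebra.Group.Subgroup.Basic
import Mathlib.Algebra.Group.Hom.End
import Mathlib.Algebra.Module.Defs
import Mathlib.Tactic.Abel
import Mathlib.Tactic.Group
import Mathlib.Tactic.LinearCombination
import HarnessLib

/-!
# The obstruction `2`-cocycle of a crossed homomorphism in an equivariant central extension
# ("Heisenberg datum"; Zarhin's quadratic map `H¹(G, M) → H²(G, A)`)

Pure algebra (topic `Literature/Algebra/Homology`, next to `GroupCohomologyCupProduct`).  Fix a monoid
`G`, additive commutative groups `M` and `A`, with actions of `G` on `M` and on `A` by additive
endomorphisms (`ρ`, `α`).  A **Heisenberg datum** (`HeisenbergDatum`) is the cochain description of a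
central extension of `G`-groups

  `0 → A → V → M → 0`,  `V = A × M` as a set, `(a, x)(b, y) = (a + b + m(x, y), x + y)`,
  `σ(a, x) = (σa + χ_σ(x), σx)`,

namely a normalized `2`-cocycle `m : M × M → A` of the abstract group `M` (associativity of `V`,
`m_cocycle`) and correction terms `χ : G × M → A` recording that the set-theoretic section
`s(x) = (0, x)` is not `G`-equivariant, subject to the two identities saying that each `σ` acts by a group
homomorphism (`smul_m`) and that the action is multiplicative in `σ` (`χ_mul`).  We CONSTRUCT the group
`V = D.Ext` (`HeisenbergDatum.Ext`, a `Group`), the central embedding `inl`, the section `sec`, the action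
`act σ : V →* V` (`act_mul`, `act_one`), and the commutator form `e(x, y) = m(x, y) − m(y, x)`
(`commForm`; `u * v = inl (e u.x v.x) * (v * u)`).

For a crossed homomorphism `ξ : G → M` (`ξ(στ) = ξ(σ) + σ ξ(τ)`, `IsCrossedHom`) the **obstruction
(connecting) cochain** is

  `conn ξ (σ, τ) := χ_σ(ξ_τ) + m(ξ_σ, σ ξ_τ) ∈ A`,

characterised by `s(ξ_σ) · σ(s(ξ_τ)) = inl(conn ξ (σ,τ)) · s(ξ_{στ})` in `V` (`sec_mul_act_sec`).  PROVED:

* `conn_cocycle` — it is a `2`-cocycle: `σ·c(τ,υ) + c(σ,τυ) = c(στ,υ) + c(σ,τ)` (the convention of the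
  tree's `contTwoCocycles`, `Literature/NumberTheory/GaloisRepresentations/ContinuousH2.lean`);
* `conn_zero`.

The sequel `HeisenbergObstructionQuadratic.lean` proves quadraticity (`conn_add`: the polar form of
`ξ ↦ [c_ξ]` is the cup product for `e`), invariance under principal crossed homomorphisms
(`conn_coboundary`), change of section (`gauge`, `conn_gauge`) and pull-back (`comap`).

Coboundaries are written in the convention of the tree's `twoCocycleClass_eq_zero_iff`
(`f(σ,τ) = σ b(τ) − b(στ) + b(σ)`).  Intended instance (cell `bsd-f1-sign2`, route `GenusKolyvaginAtTwo`):
`G = Γ_K`, `M = E[2](K̄)`, `A = μ₂`, `V` = Mumford's theta (Heisenberg) group of `𝓞(2·O)` at level `2`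
(`≅ Q₈` with its Galois action); then `ξ ↦ [conn ξ]` is the Poonen–Rains / Zarhin quadratic form
`H¹(K, E[2]) → H²(K, μ₂)` refining the Weil-pairing cup product.  That instance is NOT built here.

References: K. S. Brown, *Cohomology of Groups*, GTM 87 (1982), IV §3 (extensions and `2`-cocycles);
J.-P. Serre, *Galois Cohomology* (1997), I §5.1, §5.6–5.7 (non-abelian `H¹`, the connecting map
`δ : H¹(G, C) → H²(G, A)` of a central extension) [SerreGaloisCohomology1997]; Yu. G. Zarhin,
*Noncommutative cohomology and Mumford groups*, Mat. Zametki 15 (1974) §2; B. Poonen, E. Rains, *Random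
maximal isotropic subspaces and Selmer groups*, JAMS 25 (2012), Prop. 4.5, Cor. 4.6 [PoonenRains2012].
Elementary algebra with complete proofs; no named fact is introduced.
-/

set_option autoImplicit false

namespace Literature.Algebra.Homology

universe u v w

/-- A **Heisenberg datum**: the cochain description `(ρ, α, m, χ)` of a central extension
`0 → A → V → M → 0` of `G`-groups with a chosen set-theoretic section — `m` a normalized `2`-cocycle of
`M` with values in `A` (the multiplication `(a,x)(b,y) = (a+b+m(x,y), x+y)`), `χ_σ` the defect of
equivariance of the section (`σ(a,x) = (σa + χ_σ(x), σx)`), `smul_m` = "`σ` is a homomorphism of `V`",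
`χ_mul` = "`σ ↦ σ|_V` is multiplicative". Brown, *Cohomology of Groups*, IV §3; Serre, *Galois Cohomology*,
I §5.7. [cite: Brown1982, Ch. IV §3 (extensions defined by a 2-cocycle)] -/
structure HeisenbergDatum (G : Type u) (M : Type v) (A : Type w) [Monoid G] [AddCommGroup M]
    [AddCommGroup A] where
  /-- the action of `G` on the quotient `M` -/
  ρ : G →* AddMonoid.End M
  /-- the action of `G` on the kernel `A` -/
  α : G →* AddMonoid.End A
  /-- the `2`-cocycle of the abstract group `M` defining the multiplication of `V` -/
  m : M → M → A
  /-- the defect of `G`-equivariance of the section `x ↦ (0, x)` -/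
  χ : G → M → A
  m_zero_left : ∀ y, m 0 y = 0
  m_zero_right : ∀ x, m x 0 = 0
  m_cocycle : ∀ x y z, m x y + m (x + y) z = m y z + m x (y + z)
  smul_m : ∀ (g : G) (x y : M), α g (m x y) + χ g (x + y) = χ g x + χ g y + m (ρ g x) (ρ g y)
  χ_mul : ∀ (g h : G) (x : M), χ (g * h) x = α g (χ h x) + χ g (ρ h x)

namespace HeisenbergDatum

variable {G : Type u} {M : Type v} {A : Type w} [Monoid G] [AddCommGroup M] [AddCommGroup A]
variable (D : HeisenbergDatum G M A)

/-- `χ_σ(0) = 0` (from `smul_m` at `x = y = 0`). [cite: Brown1982, Ch. IV §3 (extensions defined by a 2-cocycle)] -/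
@[simp] theorem χ_zero (g : G) : D.χ g 0 = 0 := by
  have h := D.smul_m g 0 0
  rw [D.m_zero_left, map_zero, map_zero, D.m_zero_left, add_zero, zero_add, add_zero] at h
  -- h : χ g 0 = χ g 0 + χ g 0
  have h' : D.χ g 0 + D.χ g 0 - D.χ g 0 = 0 := by rw [← h]; exact sub_self _
  rwa [add_sub_cancel_left] at h'

/-- `χ_1 = 0` (from `χ_mul` at `g = h = 1`). [cite: Brown1982, Ch. IV §3 (extensions defined by a 2-cocycle)] -/
@[simp] theorem χ_one (x : M) : D.χ 1 x = 0 := by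
  have h := D.χ_mul 1 1 x
  simp only [one_mul, map_one, AddMonoid.End.coe_one, id_eq] at h
  have h' : D.χ 1 x + D.χ 1 x - D.χ 1 x = 0 := by rw [← h]; exact sub_self _
  rwa [add_sub_cancel_left] at h'

/-- `m(x, −x) = m(−x, x)` for a normalized `2`-cocycle. [cite: Brown1982, Ch. IV §3 (extensions defined by a 2-cocycle)] -/
theorem m_neg_comm (x : M) : D.m x (-x) = D.m (-x) x := by
  have h := D.m_cocycle x (-x) x
  rwa [add_neg_cancel, D.m_zero_left, neg_add_cancel, D.m_zero_right, add_zero, add_zero] at h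

/-- The **commutator form** `e(x, y) = m(x, y) − m(y, x)` of the datum (the commutator pairing
`M × M → A` of the central extension; for the theta group of an elliptic curve at level `2` this is the
Weil pairing, Poonen–Rains 2012 Prop. 4.5 (c)). [cite: PoonenRains2012, Prop. 4.5 (c) (commutator pairing of the Heisenberg group)] -/
def commForm (x y : M) : A := D.m x y - D.m y x

/-- Unfolding `commForm`. [cite: PoonenRains2012, Prop. 4.5 (c) (commutator pairing of the Heisenberg group)] -/
theorem commForm_apply (x y : M) : D.commForm x y = D.m x y - D.m y x := rfl

/-- `e(x, x) = 0`. [cite: PoonenRains2012, Prop. 4.5 (c) (commutator pairing of the Heisenberg group)] -/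
@[simp] theorem commForm_self (x : M) : D.commForm x x = 0 := sub_self _

/-- `e(x, y) = −e(y, x)`. [cite: PoonenRains2012, Prop. 4.5 (c) (commutator pairing of the Heisenberg group)] -/
theorem commForm_swap (x y : M) : D.commForm x y = -D.commForm y x := by
  simp only [commForm, neg_sub]

/-- `e(0, y) = 0`. [cite: PoonenRains2012, Prop. 4.5 (c) (commutator pairing of the Heisenberg group)] -/
@[simp] theorem commForm_zero_left (y : M) : D.commForm 0 y = 0 := by
  simp only [commForm, D.m_zero_left, D.m_zero_right, sub_self]

/-- `e(x, 0) = 0`. [cite: PoonenRains2012, Prop. 4.5 (c) (commutator pairing of the Heisenberg group)] -/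
@[simp] theorem commForm_zero_right (x : M) : D.commForm x 0 = 0 := by
  simp only [commForm, D.m_zero_left, D.m_zero_right, sub_self]

/-! ### The extension group `V = A ×_m M` -/

/-- The central extension `V` of `M` by `A` described by the datum: pairs `(a, x)`.
Brown, *Cohomology of Groups*, IV §3. [cite: Brown1982, Ch. IV §3 (extensions defined by a 2-cocycle)] -/
@[ext]
structure Ext (D : HeisenbergDatum G M A) : Type (max v w) where
  /-- the `A`-coordinate -/
  a : A
  /-- the `M`-coordinate -/
  x : M

namespace Ext

variable {D}

/-- Multiplication of `V`: `(a,x)(b,y) = (a+b+m(x,y), x+y)`. [folklore] -/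
instance : Mul D.Ext := ⟨fun u v => ⟨u.a + v.a + D.m u.x v.x, u.x + v.x⟩⟩

/-- Unit of `V`: `(0,0)`. [folklore] -/
instance : One D.Ext := ⟨⟨0, 0⟩⟩

/-- Inverse in `V`: `(a,x)⁻¹ = (−a − m(x,−x), −x)`. [folklore] -/
instance : Inv D.Ext := ⟨fun u => ⟨-u.a - D.m u.x (-u.x), -u.x⟩⟩

/-- `A`-coordinate of a product: `(uv).a = u.a + v.a + m(u.x, v.x)`. [cite: Brown1982, Ch. IV §3 (extensions defined by a 2-cocycle)] -/
@[simp] theorem mul_a (u v : D.Ext) : (u * v).a = u.a + v.a + D.m u.x v.x := rfl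
/-- `M`-coordinate of a product. [cite: Brown1982, Ch. IV §3 (extensions defined by a 2-cocycle)] -/
@[simp] theorem mul_x (u v : D.Ext) : (u * v).x = u.x + v.x := rfl
/-- `A`-coordinate of `1`. [cite: Brown1982, Ch. IV §3 (extensions defined by a 2-cocycle)] -/
@[simp] theorem one_a : (1 : D.Ext).a = 0 := rfl
/-- `M`-coordinate of `1`. [cite: Brown1982, Ch. IV §3 (extensions defined by a 2-cocycle)] -/
@[simp] theorem one_x : (1 : D.Ext).x = 0 := rfl
/-- `A`-coordinate of the inverse. [cite: Brown1982, Ch. IV §3 (extensions defined by a 2-cocycle)] -/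
@[simp] theorem inv_a (u : D.Ext) : u⁻¹.a = -u.a - D.m u.x (-u.x) := rfl
/-- `M`-coordinate of the inverse. [cite: Brown1982, Ch. IV §3 (extensions defined by a 2-cocycle)] -/
@[simp] theorem inv_x (u : D.Ext) : u⁻¹.x = -u.x := rfl

/-- `V` is a group (associativity is the `2`-cocycle identity of `m`). Brown IV §3. [folklore] -/
instance : Group D.Ext where
  mul_assoc u v w := by
    ext
    · simp only [mul_a, mul_x]
      linear_combination (norm := abel) D.m_cocycle u.x v.x w.x
    · simp only [mul_x, add_assoc]
  one_mul u := by
    ext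
    · simp only [mul_a, one_a, one_x, D.m_zero_left, zero_add, add_zero]
    · simp only [mul_x, one_x, zero_add]
  mul_one u := by
    ext
    · simp only [mul_a, one_a, one_x, D.m_zero_right, add_zero]
    · simp only [mul_x, one_x, add_zero]
  inv_mul_cancel u := by
    ext
    · simp only [mul_a, inv_a, inv_x, one_a, ← D.m_neg_comm u.x]
      abel
    · simp only [mul_x, inv_x, one_x, neg_add_cancel]

end Ext

/-- The central embedding `A → V`, `a ↦ (a, 0)`. [cite: Brown1982, Ch. IV §3 (extensions defined by a 2-cocycle)] -/
def inl (a : A) : D.Ext := ⟨a, 0⟩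

/-- The set-theoretic section `M → V`, `x ↦ (0, x)`. [cite: Brown1982, Ch. IV §3 (extensions defined by a 2-cocycle)] -/
def sec (x : M) : D.Ext := ⟨0, x⟩

/-- `A`-coordinate of `inl a`. [cite: Brown1982, Ch. IV §3 (extensions defined by a 2-cocycle)] -/
@[simp] theorem inl_a (a : A) : (D.inl a).a = a := rfl
/-- `M`-coordinate of `inl a`. [cite: Brown1982, Ch. IV §3 (extensions defined by a 2-cocycle)] -/
@[simp] theorem inl_x (a : A) : (D.inl a).x = 0 := rfl
/-- `A`-coordinate of `sec x`. [cite: Brown1982, Ch. IV §3 (extensions defined by a 2-cocycle)] -/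
@[simp] theorem sec_a (x : M) : (D.sec x).a = 0 := rfl
/-- `M`-coordinate of `sec x`. [cite: Brown1982, Ch. IV §3 (extensions defined by a 2-cocycle)] -/
@[simp] theorem sec_x (x : M) : (D.sec x).x = x := rfl

/-- `inl (a + b) = inl a * inl b`. [cite: Brown1982, Ch. IV §3 (extensions defined by a 2-cocycle)] -/
theorem inl_add (a b : A) : D.inl (a + b) = D.inl a * D.inl b := by
  ext <;> simp [inl, D.m_zero_left]

/-- `inl 0 = 1`. [cite: Brown1982, Ch. IV §3 (extensions defined by a 2-cocycle)] -/
@[simp] theorem inl_zero : D.inl 0 = 1 := by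
  ext <;> simp [inl]

/-- `inl` is injective. [cite: Brown1982, Ch. IV §3 (extensions defined by a 2-cocycle)] -/
theorem inl_injective : Function.Injective D.inl := fun a b h => by
  simpa [inl] using congrArg Ext.a h

/-- Every element of `V` is `inl a * sec x`. [cite: Brown1982, Ch. IV §3 (extensions defined by a 2-cocycle)] -/
theorem inl_mul_sec (a : A) (x : M) : D.inl a * D.sec x = ⟨a, x⟩ := by
  ext <;> simp [inl, sec, D.m_zero_left]

/-- `inl a` is central: `inl a * u = u * inl a`. [cite: Brown1982, Ch. IV §3 (extensions defined by a 2-cocycle)] -/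
theorem inl_mul_comm (a : A) (u : D.Ext) : D.inl a * u = u * D.inl a := by
  ext
  · simp only [Ext.mul_a, inl_a, inl_x, D.m_zero_left, D.m_zero_right, add_zero]
    exact add_comm _ _
  · simp only [Ext.mul_x, inl_x, zero_add, add_zero]

/-- The section multiplies through the cocycle: `sec x * sec y = inl (m x y) * sec (x + y)`. [cite: Brown1982, Ch. IV §3 (extensions defined by a 2-cocycle)] -/
theorem sec_mul_sec (x y : M) : D.sec x * D.sec y = D.inl (D.m x y) * D.sec (x + y) := by
  ext <;> simp [inl, sec, D.m_zero_left]

/-- The commutation rule of `V`: `u * v = inl (e(u.x, v.x)) * (v * u)`. [cite: PoonenRains2012, Prop. 4.5 (c) (commutator pairing of the Heisenberg group)] -/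
theorem mul_eq_inl_commForm_mul (u v : D.Ext) :
    u * v = D.inl (D.commForm u.x v.x) * (v * u) := by
  ext
  · simp only [Ext.mul_a, inl_a, inl_x, Ext.mul_x, D.m_zero_left, add_zero, commForm]
    abel
  · simp only [Ext.mul_x, inl_x, zero_add]
    exact add_comm _ _

/-! ### The action of `G` on `V` -/

/-- The action of `σ ∈ G` on `V`: `σ(a, x) = (σa + χ_σ(x), σx)`, a group homomorphism by `smul_m`.
Serre, *Galois Cohomology*, I §5.7 (`G`-groups). [cite: SerreGaloisCohomology1997, I §5.7 (connecting map of a central extension of G-groups)] -/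
def act (g : G) : D.Ext →* D.Ext where
  toFun u := ⟨D.α g u.a + D.χ g u.x, D.ρ g u.x⟩
  map_one' := by
    ext <;> simp
  map_mul' u v := by
    ext
    · simp only [Ext.mul_a, Ext.mul_x, map_add]
      linear_combination (norm := abel) D.smul_m g u.x v.x
    · simp only [Ext.mul_x, map_add]

/-- `A`-coordinate of `σ·u`. [cite: SerreGaloisCohomology1997, I §5.7 (connecting map of a central extension of G-groups)] -/
@[simp] theorem act_apply_a (g : G) (u : D.Ext) : (D.act g u).a = D.α g u.a + D.χ g u.x := rfl
/-- `M`-coordinate of `σ·u`. [cite: SerreGaloisCohomology1997, I §5.7 (connecting map of a central extension of G-groups)] -/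
@[simp] theorem act_apply_x (g : G) (u : D.Ext) : (D.act g u).x = D.ρ g u.x := rfl

/-- The action is multiplicative in `σ` (`χ_mul`): `(στ)·u = σ·(τ·u)`. [cite: SerreGaloisCohomology1997, I §5.7 (connecting map of a central extension of G-groups)] -/
theorem act_mul (g h : G) (u : D.Ext) : D.act (g * h) u = D.act g (D.act h u) := by
  ext
  · simp only [act_apply_a, act_apply_x, map_mul, AddMonoid.End.coe_mul, Function.comp_apply, map_add,
      D.χ_mul, add_assoc]
  · simp only [act_apply_x, map_mul, AddMonoid.End.coe_mul, Function.comp_apply]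

/-- The unit acts trivially. [cite: SerreGaloisCohomology1997, I §5.7 (connecting map of a central extension of G-groups)] -/
@[simp] theorem act_one (u : D.Ext) : D.act 1 u = u := by
  ext
  · simp only [act_apply_a, map_one, AddMonoid.End.coe_one, id_eq, χ_one, add_zero]
  · simp only [act_apply_x, map_one, AddMonoid.End.coe_one, id_eq]

/-- `σ` acts on the centre through `α`: `σ·inl(a) = inl(σa)`. [cite: SerreGaloisCohomology1997, I §5.7 (connecting map of a central extension of G-groups)] -/
@[simp] theorem act_inl (g : G) (a : A) : D.act g (D.inl a) = D.inl (D.α g a) := by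
  ext <;> simp [inl]

/-- `σ` on the section: `σ·sec(x) = inl(χ_σ x) * sec(σx)`. [cite: SerreGaloisCohomology1997, I §5.7 (connecting map of a central extension of G-groups)] -/
theorem act_sec (g : G) (x : M) : D.act g (D.sec x) = D.inl (D.χ g x) * D.sec (D.ρ g x) := by
  ext <;> simp [inl, sec, D.m_zero_left]

/-! ### Crossed homomorphisms and the obstruction cocycle -/

/-- `ξ : G → M` is a crossed homomorphism (inhomogeneous `1`-cocycle): `ξ(στ) = ξ(σ) + σ ξ(τ)`.
Serre, *Galois Cohomology*, I §5.1. [cite: SerreGaloisCohomology1997, I §5.1 (cocycles, crossed homomorphisms)] -/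
def IsCrossedHom (ξ : G → M) : Prop := ∀ g h : G, ξ (g * h) = ξ g + D.ρ g (ξ h)

variable {D} in
/-- The sum of two crossed homomorphisms is one. [cite: SerreGaloisCohomology1997, I §5.1 (cocycles, crossed homomorphisms)] -/
theorem IsCrossedHom.add {ξ η : G → M} (hξ : D.IsCrossedHom ξ) (hη : D.IsCrossedHom η) :
    D.IsCrossedHom (ξ + η) := fun g h => by
  simp only [Pi.add_apply, hξ g h, hη g h, map_add]
  abel

/-- A principal crossed homomorphism `σ ↦ σx − x` is a crossed homomorphism. [cite: SerreGaloisCohomology1997, I §5.1 (cocycles, crossed homomorphisms)] -/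
theorem isCrossedHom_principal (x : M) : D.IsCrossedHom (fun g => D.ρ g x - x) := fun g h => by
  simp only [map_mul, AddMonoid.End.coe_mul, Function.comp_apply, map_sub]
  abel

/-- The **obstruction (connecting) `2`-cochain** of `ξ`: `conn ξ (σ, τ) = χ_σ(ξ_τ) + m(ξ_σ, σξ_τ)` — the
element of `A` by which `s(ξ_σ)·σ(s(ξ_τ))` differs from `s(ξ_{στ})` (`sec_mul_act_sec`); its class is
`δ[ξ] ∈ H²(G, A)` for the connecting map `δ : H¹(G, M) → H²(G, A)` of the central extension
(Serre I §5.7; Zarhin 1974 §2; Poonen–Rains 2012 Cor. 4.6). [cite: SerreGaloisCohomology1997, I §5.7 (connecting map of a central extension of G-groups)] -/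
def conn (ξ : G → M) (g h : G) : A := D.χ g (ξ h) + D.m (ξ g) (D.ρ g (ξ h))

/-- Unfolding `conn`. [cite: SerreGaloisCohomology1997, I §5.7 (connecting map of a central extension of G-groups)] -/
theorem conn_apply (ξ : G → M) (g h : G) :
    D.conn ξ g h = D.χ g (ξ h) + D.m (ξ g) (D.ρ g (ξ h)) := rfl

/-- `conn` of the zero cochain vanishes. [cite: SerreGaloisCohomology1997, I §5.7 (connecting map of a central extension of G-groups)] -/
@[simp] theorem conn_zero (g h : G) : D.conn 0 g h = 0 := by
  simp [conn, D.m_zero_left]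

/-- The defining relation in `V`: `s(ξ_σ) · σ(s(ξ_τ)) = inl(conn ξ (σ,τ)) · s(ξ_{στ})` for a crossed
homomorphism `ξ`. Serre, *Galois Cohomology*, I §5.7. [cite: SerreGaloisCohomology1997, I §5.7 (connecting map of a central extension of G-groups)] -/
theorem sec_mul_act_sec {ξ : G → M} (hξ : D.IsCrossedHom ξ) (g h : G) :
    D.sec (ξ g) * D.act g (D.sec (ξ h)) = D.inl (D.conn ξ g h) * D.sec (ξ (g * h)) := by
  ext
  · simp [inl, sec, conn, D.m_zero_left]
  · simp [inl, sec, hξ g h]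

/-- **The obstruction cochain is a `2`-cocycle** (with the action `α` on `A`):
`σ·c(τ,υ) + c(σ,τυ) = c(στ,υ) + c(σ,τ)` — the convention of the tree's `contTwoCocycles`.  Proof:
evaluate `s(ξ_σ)·σ(s(ξ_τ))·στ(s(ξ_υ))` in two ways in `V`. Serre, *Galois Cohomology*, I §5.7;
Brown IV §3. [cite: SerreGaloisCohomology1997, I §5.7 (connecting map of a central extension of G-groups)] -/
theorem conn_cocycle {ξ : G → M} (hξ : D.IsCrossedHom ξ) (g h k : G) :
    D.α g (D.conn ξ h k) + D.conn ξ g (h * k) = D.conn ξ (g * h) k + D.conn ξ g h := by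
  have e1 : D.sec (ξ g) * D.act g (D.sec (ξ h)) * D.act (g * h) (D.sec (ξ k))
      = D.inl (D.conn ξ g h + D.conn ξ (g * h) k) * D.sec (ξ (g * h * k)) := by
    rw [sec_mul_act_sec D hξ g h, mul_assoc, sec_mul_act_sec D hξ (g * h) k, ← mul_assoc,
      ← inl_add]
  have e2 : D.sec (ξ g) * D.act g (D.sec (ξ h)) * D.act (g * h) (D.sec (ξ k))
      = D.inl (D.α g (D.conn ξ h k) + D.conn ξ g (h * k)) * D.sec (ξ (g * h * k)) := by
    rw [act_mul, mul_assoc, ← map_mul, sec_mul_act_sec D hξ h k, map_mul, act_inl, ← mul_assoc,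
      ← inl_mul_comm, mul_assoc, sec_mul_act_sec D hξ g (h * k), ← mul_assoc, ← inl_add, mul_assoc g h k]
  have key := D.inl_injective (mul_right_cancel (e2.symm.trans e1))
  rw [key, add_comm]

end HeisenbergDatum

end Literature.Algebra.Homology
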